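import Literature.NumberTheory.DiophantineGeometry.GarciaStichtenothTower
import Literature.NumberTheory.DiophantineGeometry.FunctionFieldDifferentialBounds
import HarnessLib

/-!
# The Garcia–Stichtenoth tower: the differential `dx₀` (local bounds on its divisor)

Topic: `Literature/NumberTheory/DiophantineGeometry` (sub-namespace `GSTower`). In the tower
`x_{i+1}^q - x_{i+1} = u(x_i)`, `u(z) = z^q/(1 - z^{q-1})`, over a field in which `q = 0`,
differentiating the defining relation gives `-dx_{i+1} = u'(x_i) dx_i` with
`u'(z) = -z^{2q-2}/(1 - z^{q-1})²`, i.e.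

  `dx_{i+1} = D(x_i) dx_i`,  `D(z) = z^{2q-2}/(1 - z^{q-1})²`,  so  `dx_N = g dx₀`, `g = ∏_{i<N} D(x_i)`,

as identities of local residues at every place (`localRes_root_eq`, `Level.localRes_x_eq`; Tate's
residues of `FunctionFieldResidues`). Consequently the divisor `W = (dx₀)` of the Weil differential
`dx₀ = dOf K x₀` is bounded above at a place `Q` of a level `G_N` as soon as a local parameter is
known there (`FunctionFieldDifferentialBounds.differentialDivisor_dOf_le_ord`):

* `Level.differentialDivisor_le_of_ord_x_N` — if `v_Q(x_N) = -1` then `W(Q) ≤ -v_Q(g) - 2`;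
* `Level.differentialDivisor_le_of_chart` — if `f(x₀)` is a local parameter with `f'(x₀)` a unit
  (`f ∈ K[T]`) then `W(Q) ≤ 0`;
* `Level.differentialDivisor_le_of_ord_sub_eq_one` — if `v_Q(x₀ - β) = 1` then `W(Q) ≤ 0`.

This replaces, for the genus computation of the tower, the Hurwitz genus formula and the
different exponents of [Stichtenoth 2009, Lemma 7.4.6]: `2g - 2 = deg (dx₀)` is bounded place by
place.

## References

* H. Stichtenoth, *Algebraic Function Fields and Codes*, 2nd ed., GTM 254 (2009): §4.3 (local
  components of differentials), Lemma 7.4.6, Thm. 7.4.7 (proof). [Stichtenoth2009]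
* J. Tate, *Residues of differentials on curves*, Ann. Sci. ÉNS 1 (1968): §2 (R1)–(R4). [Tate1968]
-/

noncomputable section

open scoped Classical Polynomial IntermediateField
open Polynomial

namespace Literature.NumberTheory.DiophantineGeometry

open AlgFunctionField

namespace GSTower

universe u v

/-! ### `dy = D(x) dx` for `y^q - y = u(x)` -/

section Relation

variable {K : Type u} {F : Type v} [Field K] [Field F] [Algebra K F] [IsAlgFunctionField K F]

/-- **`dy = D(x) dx`**: if `y^q - y = u(x) = x^q/(1 - x^{q-1})` with `q = 0` in `K` (`q ≥ 2`,
`x^{q-1} ≠ 1`), then `res_P(a dy) = res_P(a D(x) dx)` at every place `P`, where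
`D(x) = x^{2q-2}/(1 - x^{q-1})²` (`d(y^q) = 0`, `d(1 - x^{q-1}) = x^{q-2} dx`).
[cite: Stichtenoth2009, Lemma 7.4.6 (proof)] -/
theorem localRes_eq_of_pow_sub_eq (P : PlaceOver K F) {q : ℕ} (hq : 2 ≤ q) (hqK : (q : K) = 0)
    {x y : F} (h1 : 1 - x ^ (q - 1) ≠ 0) (hy : y ^ q - y = u q x) (a : F) :
    P.localRes K a y = P.localRes K (a * (x ^ (2 * q - 2) / (1 - x ^ (q - 1)) ^ 2)) x := by
  obtain ⟨m, rfl⟩ : ∃ m, q = m + 2 := ⟨q - 2, by omega⟩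
  have hcast1 : ((m + 1 : ℕ) : K) + 1 = 0 := by exact_mod_cast hqK
  have hm1 : ((m : K) + 1) = -1 := by
    have : ((m : K) + 1) + 1 = 0 := by exact_mod_cast hqK
    linear_combination this
  simp only [show m + 2 - 1 = m + 1 by omega, show 2 * (m + 2) - 2 = (m + 1) + (m + 1) by omega] at h1 hy ⊢
  set w := 1 - x ^ (m + 1) with hw
  -- `res(a d(y^q - y)) = -res(a dy)`
  have hL : P.localRes K a (y ^ (m + 2) - y) = -P.localRes K a y := by
    rw [P.localRes_sub_right, P.localRes_pow_right, show ((m + 1 : ℕ) : K) + 1 = 0 from hcast1, zero_mul,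
      zero_sub]
  -- `res(a d(u x)) = -res(a x^{2q-2} w⁻² dx)`
  have hdw : ∀ b : F, P.localRes K b w = P.localRes K (b * x ^ m) x := fun b => by
    rw [hw, P.localRes_sub_right, P.localRes_one_right, zero_sub, P.localRes_pow_right, hm1]
    ring
  have hR : P.localRes K a (u (m + 2) x) = -P.localRes K (a * (x ^ (m + 1 + (m + 1)) / w ^ 2)) x := by
    rw [u, show m + 2 - 1 = m + 1 by omega, ← hw, div_eq_mul_inv, P.localRes_mul_right,
      P.localRes_inv_right _ h1, hdw, P.localRes_pow_right, hcast1, zero_mul, add_zero]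
    congr 2
    rw [div_eq_mul_inv, inv_pow]; ring
  rw [hy] at hL
  rw [hL] at hR
  have := neg_eq_iff_eq_neg.1 hR.symm |>.symm
  rw [neg_neg] at this
  rw [← this]

end Relation

/-! ### `dx_N = g dx₀` on a level, and the local bounds on `(dx₀)` -/

namespace Level

variable {K : Type} [Field K] {q : ℕ} [hq : Fact (2 ≤ q)] (L : Level K q)

/-- `1 - x_i^{q-1} ≠ 0` (it has a pole at `P_∞`). [folklore] -/
theorem one_sub_pow_ne_zero {i : ℕ} (hi : i ≤ L.N) : 1 - L.x i ^ (q - 1) ≠ 0 :=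
  (ord_u_of_ord_neg L.Pinf hq.out (by rw [L.ord_Pinf i hi]; exact neg_neg_of_pos (by
    have := hq.out; positivity))).1.1

/-- **`dx_k = (∏_{i<k} D(x_i)) dx₀`** as an identity of local residues at every place of `G_N`
(`k ≤ N`), from `dx_{i+1} = D(x_i) dx_i`. [cite: Stichtenoth2009, Lemma 7.4.6 (proof)] -/
theorem localRes_x_eq (hqK : (q : K) = 0) (P : PlaceOver K L.carrier) {k : ℕ} (hk : k ≤ L.N) (a : L.carrier) :
    P.localRes K a (L.x k) = P.localRes K (a * ∏ i ∈ Finset.range k,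
      (L.x i ^ (2 * q - 2) / (1 - L.x i ^ (q - 1)) ^ 2)) (L.x 0) := by
  induction k generalizing a with
  | zero => rw [Finset.prod_range_zero, mul_one]
  | succ k ih =>
    rw [localRes_eq_of_pow_sub_eq P hq.out hqK (L.one_sub_pow_ne_zero (by omega)) (L.rel k (by omega)) a,
      ih (by omega), Finset.prod_range_succ, mul_assoc, mul_comm (∏ i ∈ Finset.range k, _)]

/-- The conversion factor `g = ∏_{i<N} D(x_i)` is non-zero. [folklore] -/
theorem prod_ne_zero_aux {k : ℕ} (hk : k ≤ L.N) :
    (∏ i ∈ Finset.range k, (L.x i ^ (2 * q - 2) / (1 - L.x i ^ (q - 1)) ^ 2)) ≠ 0 :=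
  Finset.prod_ne_zero_iff.2 fun i hi => div_ne_zero (pow_ne_zero _ (L.x_ne_zero (by
    have := Finset.mem_range.1 hi; omega))) (pow_ne_zero _ (L.one_sub_pow_ne_zero (by
    have := Finset.mem_range.1 hi; omega)))

variable [Finite K]

/-- **Chart `1/x_N`**: at a place `Q` of `G_N` with `v_Q(x_N) = -1`, `dx₀ ≠ 0` and
`(dx₀)_Q ≤ -v_Q(g) - 2`, `g = ∏_{i<N} D(x_i)` (`dx₀ = g⁻¹ dx_N = -g⁻¹ x_N² d(1/x_N)`).
[cite: Stichtenoth2009, Lemma 7.4.6] -/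
theorem differentialDivisor_le_of_ord_x_N [IsIntegrallyClosedIn K L.carrier] (hqK : (q : K) = 0)
    {Q : PlaceOver K L.carrier} (hN : Q.ord (L.x L.N) = -1) :
    dOf K (L.x 0) ≠ 0 ∧ differentialDivisor (dOf K (L.x 0)) Q ≤
      -Q.ord (∏ i ∈ Finset.range L.N, (L.x i ^ (2 * q - 2) / (1 - L.x i ^ (q - 1)) ^ 2)) - 2 := by
  set g := ∏ i ∈ Finset.range L.N, (L.x i ^ (2 * q - 2) / (1 - L.x i ^ (q - 1)) ^ 2) with hg
  have hg0 : g ≠ 0 := L.prod_ne_zero_aux le_rfl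
  have hx0 : L.x L.N ≠ 0 := L.x_ne_zero le_rfl
  set t := (L.x L.N)⁻¹ with ht
  have ht1 : Q.ord t = 1 := by rw [ht, Q.ord_inv hx0, hN]; rfl
  have ht0 : t ≠ 0 := inv_ne_zero hx0
  have hc0 : -(g⁻¹ * t⁻¹ ^ 2) ≠ 0 := neg_ne_zero.2 (mul_ne_zero (inv_ne_zero hg0) (pow_ne_zero _ (inv_ne_zero ht0)))
  have hconv : ∀ a : L.carrier, Q.localRes K a (L.x 0) = Q.localRes K (a * -(g⁻¹ * t⁻¹ ^ 2)) t := by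
    intro a
    have h1 : Q.localRes K a (L.x 0) = Q.localRes K (a * g⁻¹) (L.x L.N) := by
      rw [L.localRes_x_eq hqK Q le_rfl, ← hg, mul_assoc, inv_mul_cancel₀ hg0, mul_one]
    rw [h1, show L.x L.N = t⁻¹ by rw [ht, inv_inv], Q.localRes_inv_right _ ht0, ← Q.localRes_neg_left]
    congr 1; ring
  obtain ⟨hω, hle⟩ := Q.differentialDivisor_dOf_le_ord ht1 hc0 hconv
  refine ⟨hω, hle.trans (le_of_eq ?_)⟩
  rw [Q.ord_neg, Q.ord_mul_eq (inv_ne_zero hg0) (pow_ne_zero _ (inv_ne_zero ht0)), Q.ord_inv hg0,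
    Q.ord_pow (inv_ne_zero ht0), Q.ord_inv ht0, ht1]
  ring

omit hq in
/-- **Polynomial chart**: at a place `Q` of `G_N` where `f(x₀)` is a local parameter with `f'(x₀)` a
unit (`f ∈ K[T]`), `(dx₀)_Q ≤ 0` (`dx₀ = f'(x₀)⁻¹ d f(x₀)`). [cite: Stichtenoth2009, Lemma 7.4.5] -/
theorem differentialDivisor_le_of_chart [IsIntegrallyClosedIn K L.carrier] {Q : PlaceOver K L.carrier}
    {f : K[X]} (h1 : Q.ord (aeval (L.x 0) f) = 1) (hd0 : aeval (L.x 0) (derivative f) ≠ 0)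
    (h0 : Q.ord (aeval (L.x 0) (derivative f)) = 0) :
    dOf K (L.x 0) ≠ 0 ∧ differentialDivisor (dOf K (L.x 0)) Q ≤ 0 := by
  have hconv : ∀ a : L.carrier, Q.localRes K a (L.x 0) =
      Q.localRes K (a * (aeval (L.x 0) (derivative f))⁻¹) (aeval (L.x 0) f) := fun a => by
    rw [Q.localRes_aeval_right, mul_assoc, inv_mul_cancel₀ hd0, mul_one]
  obtain ⟨hω, hle⟩ := Q.differentialDivisor_dOf_le_ord h1 (inv_ne_zero hd0) hconv
  exact ⟨hω, hle.trans (by rw [Q.ord_inv hd0, h0, neg_zero])⟩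

omit hq in
/-- **Chart `x₀ - β`**: at a place `Q` of `G_N` with `v_Q(x₀ - β) = 1` (`β ∈ K`), `(dx₀)_Q ≤ 0`
(`dx₀ = d(x₀ - β)`). [cite: Stichtenoth2009, Lemma 7.4.6] -/
theorem differentialDivisor_le_of_ord_sub_eq_one [IsIntegrallyClosedIn K L.carrier] {Q : PlaceOver K L.carrier}
    {β : K} (h1 : Q.ord (L.x 0 - algebraMap K L.carrier β) = 1) :
    dOf K (L.x 0) ≠ 0 ∧ differentialDivisor (dOf K (L.x 0)) Q ≤ 0 := by
  have hconv : ∀ a : L.carrier, Q.localRes K a (L.x 0) =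
      Q.localRes K (a * 1) (L.x 0 - algebraMap K L.carrier β) := fun a => by
    rw [mul_one, Q.localRes_sub_right, Q.localRes_algebraMap_right, sub_zero]
  obtain ⟨hω, hle⟩ := Q.differentialDivisor_dOf_le_ord h1 one_ne_zero hconv
  exact ⟨hω, hle.trans (by rw [Q.ord_one])⟩

end Level

end GSTower

end Literature.NumberTheory.DiophantineGeometry
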